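import Mathlib.RingTheory.PowerSeries.Inverse
import Mathlib.RingTheory.PowerSeries.NoZeroDivisors
import Mathlib.RingTheory.Ideal.Quotient.Operations
import Mathlib.NumberTheory.Padics.PadicIntegers
import Literature.NumberTheory.EllipticCurves.IwasawaDivisibilityTransfer
import HarnessLib

/-!
# Route `AdditiveKolyvaginRoad`, crux KS′ `LevelKolyvaginSystemsAdditive` (item stmt-BirchSwinnertonDyer-21396): `C ϖ` IS PRIME IN `R⟦T⟧`
# and THE `μ`-SPLITTING HEART — the First Lemma `MuSplittingHeart` of crux-idea card `hsieh-mu-direct` (triage PASS), typed there as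
# «TRUE: p is a prime element of ℤ_p⟦X⟧ since ℤ_p⟦X⟧/(p) = 𝔽_p⟦X⟧ is a domain; size S»
# (cell `pub/bsd-wall`, width seat `bsd-wall-akr-p2x-w2` g8; `--supports stmt-BirchSwinnertonDyer-21396`, helper)

THEOREMS ONLY (no definition, no named fact, no `sorry`); pure commutative algebra, no elliptic curve in the statements.  BSD is not
proved by any of this; KS′/KPA′ stay OPEN.

THE POINT.  Card `hsieh-mu-direct` (`Cruxes/LevelKolyvaginSystemsAdditive/Ideas/hsieh-mu-direct.md`) runs Hsieh's `μ = 0` theorem for the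
anticyclotomic `p`-adic `L`-function `𝓛` directly at the additive prime: «(C2)_ℚ gives `𝓛 ∣ p^a·char(X)`, `X_{∅,0} = 0` makes `char` a unit, so
`𝓛 ∣ p^a` in `Λ^{ur}`; `μ(𝓛) = 0` (Hsieh) then forces `𝓛 ∈ Λ^{ur,×}` (First lemma `MuSplittingHeart`: `ℤ_p⟦X⟧` is a UFD in which `p` is
prime), hence `𝓛(𝟙)` is a `p`-unit (`UnitIffConstantCoeffUnit`)».  The two support lemmas it names as «K3 (support, provable now)» are made
theorems here, the second being Mathlib's `PowerSeries.isUnit_iff_constantCoeff` verbatim (not restated):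

* §1 `C_dvd_iff_forall_dvd_coeff`, **`prime_C_of_prime`** — for ANY commutative ring `R` and a prime element `ϖ ∈ R`, the constant `C ϖ`
  is a PRIME element of `R⟦T⟧` (`C ϖ ∣ F ⟺ ϖ` divides every coefficient ⟺ `F̄ = 0` in `(R/ϖ)⟦T⟧`, a domain).  The power-series twin of
  Mathlib's `Polynomial.prime_C_iff` ∕ `MvPolynomial.prime_C_iff` (absent for `PowerSeries`); with it «`μ(F) = 0`» reads «`C p ∤ F`» with no
  appeal to unique factorisation in `Λ`.
* §2 **`muSplittingHeart`** — the card's `MuSplittingHeart` VERBATIM: `∀ p F G a, F·G = C(p^a) → ¬ C p ∣ F → IsUnit F` in `ℤ_p⟦T⟧`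
  (§1 + the tree's `IwasawaTransfer.isUnit_of_dvd_prime_pow_mul_of_not_dvd`, the ring-theoretic `μ = 0` descent step isolated from BSTW).
Companion file: `…AdditiveKolyvaginRoadGreenbergVatsalPin.lean` (the Greenberg–Vatsal pin of card `residual-bdp-transport`).  Placement note:
pure algebra of the same kind as `Literature.NumberTheory.EllipticCurves.IwasawaTransfer`; a librarian may re-home it there unchanged.

References (locators only): [cite: Washington1997, §7.1 (Λ = ℤ_p⟦T⟧, μ-invariant, Λ/pΛ ≅ 𝔽_p⟦T⟧)] [cite: GreenbergVatsal2000, §1 (μ = 0)]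
[cite: Hsieh2014, Thm. 1–2 (μ = 0 for the anticyclotomic L-function; the card's (K1))].
-/

-- single-conjunct summit: `Summit.BirchSwinnertonDyer.BirchSwinnertonDyer.…` repeats the name by design
set_option linter.dupNamespace false

set_option autoImplicit false

noncomputable section

open scoped Classical

namespace Summit.BirchSwinnertonDyer.BirchSwinnertonDyer.Theorems.AdditiveKoly.MuSplitting

open PowerSeries

/-! ## §1 `C ϖ` is prime in `R⟦T⟧` -/

section PrimeC

variable {R : Type*} [CommRing R]

/-- `C a ∣ F` iff `a` divides every coefficient of `F`. [folklore] -/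
theorem C_dvd_iff_forall_dvd_coeff (a : R) (F : PowerSeries R) :
    (C a : PowerSeries R) ∣ F ↔ ∀ n : ℕ, a ∣ coeff n F := by
  constructor
  · rintro ⟨H, rfl⟩ n
    exact ⟨coeff n H, by rw [coeff_C_mul]⟩
  · intro h
    choose c hc using h
    refine ⟨PowerSeries.mk c, ?_⟩
    ext n
    rw [coeff_C_mul, coeff_mk, ← hc]

/-- **`C ϖ` is a prime element of `R⟦T⟧` for every prime element `ϖ` of a commutative ring `R`** — the power-series twin of Mathlib's
`Polynomial.prime_C_iff`.  Proof: `C ϖ ∣ F` iff every coefficient of `F` lies in `(ϖ)` iff the image of `F` in `(R/(ϖ))⟦T⟧` vanishes;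
`(ϖ)` is a prime ideal, so `(R/(ϖ))⟦T⟧` is a domain and `F̄·Ḡ = 0` forces `F̄ = 0` or `Ḡ = 0`.  In Iwasawa theory (`R = ℤ_p` or `ℤ_p^{ur}`,
`ϖ = p`): «`μ(F) = 0`» is «`C p ∤ F`», and `p`-power divisibilities split along the prime `C p`. [cite: Washington1997, §7.1 (μ-invariant; Λ/pΛ = 𝔽_p⟦T⟧ is a domain)] -/
theorem prime_C_of_prime {ϖ : R} (hϖ : Prime ϖ) : Prime (C ϖ : PowerSeries R) := by
  classical
  set I : Ideal R := Ideal.span {ϖ} with hI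
  haveI hIp : I.IsPrime := (Ideal.span_singleton_prime hϖ.ne_zero).mpr hϖ
  haveI : IsDomain (R ⧸ I) := (Ideal.Quotient.isDomain_iff_prime I).mpr hIp
  -- `C ϖ ∣ F` iff the reduction of `F` mod `ϖ` vanishes
  have hred : ∀ F : PowerSeries R,
      (C ϖ : PowerSeries R) ∣ F ↔ PowerSeries.map (Ideal.Quotient.mk I) F = 0 := by
    intro F
    rw [C_dvd_iff_forall_dvd_coeff]
    constructor
    · intro h
      ext n
      rw [coeff_map, map_zero, Ideal.Quotient.eq_zero_iff_mem, hI, Ideal.mem_span_singleton]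
      exact h n
    · intro h n
      have hn := congrArg (coeff n) h
      rw [coeff_map, map_zero, Ideal.Quotient.eq_zero_iff_mem, hI, Ideal.mem_span_singleton] at hn
      exact hn
  refine ⟨?_, ?_, ?_⟩
  · -- `C ϖ ≠ 0`
    intro h0
    apply hϖ.ne_zero
    have : (C ϖ : PowerSeries R) = C 0 := by rw [h0, map_zero]
    exact C_injective this
  · -- not a unit
    intro hu
    apply hϖ.not_unit
    have := isUnit_iff_constantCoeff.mp hu
    rwa [constantCoeff_C] at this
  · -- `C ϖ ∣ F * G → C ϖ ∣ F ∨ C ϖ ∣ G`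
    intro F G hFG
    rw [hred] at hFG ⊢
    rw [hred]
    rw [map_mul] at hFG
    exact mul_eq_zero.mp hFG

end PrimeC

/-! ## §2 The `μ`-splitting heart (card `hsieh-mu-direct`, First Lemma `MuSplittingHeart` VERBATIM) -/

/-- **The `μ`-splitting heart** — the sister crux-idea card `hsieh-mu-direct`'s First Lemma `MuSplittingHeart` VERBATIM («μ = 0 + a
rational divisibility + X = 0 ⇒ unit», «TRUE: `p` is a prime element of `ℤ_p⟦X⟧` since `ℤ_p⟦X⟧/(p) = 𝔽_p⟦X⟧ is a domain; size S»): in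
`ℤ_p⟦T⟧`, if `F·G = C(p^a)` and `C p ∤ F` (i.e. `μ(F) = 0`), then `F` is a unit.  By §1 (`C p` is prime) and the tree's
`IwasawaTransfer.isUnit_of_dvd_prime_pow_mul_of_not_dvd` (BSTW's `μ = 0` descent step: a divisor of `ϖ^k·u` not divisible by the prime `ϖ`
is a unit).  The card's other support lemma `UnitIffConstantCoeffUnit` is Mathlib's `PowerSeries.isUnit_iff_constantCoeff`. [cite: Washington1997, §7.1]
[cite: GreenbergVatsal2000, §1 (μ = 0 and the p-adic valuation of the constant term)] -/
theorem muSplittingHeart :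
    ∀ (p : ℕ) [Fact p.Prime] (F G : PowerSeries ℤ_[p]) (a : ℕ),
      F * G = PowerSeries.C ((p : ℤ_[p]) ^ a) → ¬ (PowerSeries.C (p : ℤ_[p]) ∣ F) → IsUnit F := by
  intro p _ F G a hFG hnd
  have hC : Prime (C (p : ℤ_[p]) : PowerSeries ℤ_[p]) := prime_C_of_prime PadicInt.prime_p
  refine Literature.NumberTheory.EllipticCurves.IwasawaTransfer.isUnit_of_dvd_prime_pow_mul_of_not_dvd hC isUnit_one
    hnd a ⟨G, ?_⟩
  rw [mul_one, ← map_pow, ← hFG]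

end Summit.BirchSwinnertonDyer.BirchSwinnertonDyer.Theorems.AdditiveKoly.MuSplitting

end
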